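import Summits.ABC.StewartYu.PadicW80Sizes3C
import HarnessLib

/-!
# The `q = 3` (`p = 2`) parameter record — the archimedean sizes, IV: the FRAME side, part 2 (clearing
# denominators, terms, cores, third-point weights) in the consumers' closed forms

Support file (theorems only; no named fact), cell `abc-stewartyu` (seat p5; crux `W80Two`
stmt-ABC-19486; route `PadicPrimesW80TwoThirds`).  Sequel to `PadicW80Sizes3C.lean`: for a sign-free
datum `Q : SetupQ` at the record `P : PadicW80ParL Q.d` under `hy : Q.flat.SizeHyp P.V P.Vθ P.W`, the
bounds of p2's clearing denominator `Dclear3` (`DescentIntegralityThirdQ`) and of the cores in EXACTLY the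
closed forms of `PadicW80Par3` that the landed consumers take — base-`3` twin of `PadicW80SizesLC/LPM`:
* **`cast_Dclear3_le`** (`Dclear3_J(s,τ) ≤ 𝔔³·E(c)` for `τ₀, |τ'| ≤ T`, `s ≤ 3ᴶ c S₀`:
  `ν(h)^{τ₀} ≤ 𝔔²` (p1), `|b_θ|^{|τ'|} ≤ 𝔔`, denominators `≤ E(c)`), `Dclear3_le_DmaxK3` (inner step `k`:
  `s < 3^{k+1+J}S₀`, `≤ 𝔔¹⁶E(3^{k+1})`), `Dclear3_le_DmaxT3` (third points `s < 3^{J+1}S₀`, `≤ 𝔔¹⁶E(3)`);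
* **`abs_qTerm3_le_of_le`** / **`abs_qTerm3_le`** (`|qTerm3_J| ≤ 𝔔⁴·𝔔·E(c) = 𝔔⁵E(c)`; `c = 3^{k+1}` at the inner step `k`), **`abs_Dclear3_qTerm3_le_Amax3`** (the `hA`
  of `TwoSetup.siegel3_of_count` with `Dc := Dclear3 0`: `𝔔⁸E(2) ≤ Amax3 = 𝔔²¹E(3)`),
  **`abs_coreSum3_le_MmaxK3`** (the size half of `TwoSetup.KSizes3`: `|p(u)| ≤ P_int ≤ PrV3`,
  `#box3 ≤ 𝔔` ⇒ `|coreSum3| ≤ MmaxK3 k`);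
* **`abs_thirdWeight_le_RThird3`** (`|qΔ3_{J+1}·qA·qEt| ≤ 𝔔⁵E(3) = RThird3`) and
  **`sum_thirdWeight_le_MmaxT3`** (the `hMbP` of `TwoSetup.thirdStep_of_numerics` with `Mb := MmaxT3`).
Everything is [folklore] book-keeping on [cite: Waldschmidt1980, Lemma 3.2, §3.3–3.4 (pp. 266–270)] and
[cite: Yu1989, §3].

## References
* [Waldschmidt1980] M. Waldschmidt, *A lower bound for linear forms in logarithms*, Acta Arith. 37
  (1980), Lemma 3.2 (pp. 266–267), Lemma 3.4 and (3.19)–(3.22) (pp. 269–270).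
* [Yu1989] K. Yu, *Linear forms in p-adic logarithms*, Acta Arith. 53 (1989), §3 Lemmas 3.1–3.5.
-/

noncomputable section

open Finset Real
open Literature.NumberTheory.Transcendental
open Literature.NumberTheory.Transcendental.CW77
open Literature.NumberTheory.Transcendental.CW77.Setup (Idx Tau tauNorm tauSet)

namespace Literature.NumberTheory.Transcendental.CW77

namespace Setup

open Summit.ABC.StewartYu
open Summit.ABC.StewartYu.PadicW80Par (cLp' cTp cLp mRp)
open Summit.ABC.StewartYu.PadicW80ParL (mR_pos two_le_mR)

variable {Q : SetupQ} {P : PadicW80ParL Q.d} (hy : Q.flat.SizeHyp P.V P.Vθ P.W)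
include hy


/-! #### The clearing denominators -/

/-- **`Dclear3_J(s,τ) ≤ 𝔔³ · E(c)`** for `τ₀ ≤ T`, `|τ'| ≤ T`, `s ≤ 3ᴶ c S₀`
(`ν(h)^{τ₀} ≤ 𝔔²`, `|b_θ|^{|τ'|} ≤ 𝔔`, denominators `≤ E(c)`). [cite: Waldschmidt1980, Lemma 3.4 (p. 269)] -/
theorem SizeHyp.cast_Dclear3_le {J c : ℕ} {τ : Tau Q.d} (hτ1 : τ.1 ≤ P.T3) (hτ2 : ∑ j, τ.2 j ≤ P.T3)
    {s : ℕ} (hs : s ≤ 3 ^ J * (c * P.S₀3)) :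
    ((Q.Dclear3 (h := P.hparℓ) J P.L3 P.Lθ3 s τ : ℕ) : ℝ) ≤ P.𝔔3 ^ 3 * P.Efac3 c := by
  unfold SetupQ.Dclear3
  rw [Nat.cast_mul, Nat.cast_mul]
  have h1 : ((Waldschmidt1980.nu P.hparℓ ^ τ.1 : ℕ) : ℝ) ≤ P.𝔔3 ^ 2 := by
    rw [Nat.cast_pow]; exact P.nu_pow_le_𝔔3 hτ1
  have h2 : ((Q.bθ.natAbs ^ (∑ j, τ.2 j) : ℕ) : ℝ) ≤ P.𝔔3 ^ 1 := by
    rw [pow_one]; exact hy.natAbs_bθ_pow3_le_𝔔3 hτ2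
  have h3 : (((∏ j, (Q.α j).den ^ (P.L3 j / 3 ^ J * s)) * Q.θ.den ^ (P.Lθ3 / 3 ^ J * s) : ℕ) : ℝ) ≤
      P.Efac3 c :=
    hy.den_prod3_le (fun j => SetupQ.div_pow_mul_le hs) (SetupQ.div_pow_mul_le hs)
  have h12 := P.mul_le_𝔔3_pow h1 h2 (Nat.cast_nonneg _)
  exact mul_le_mul h12 h3 (Nat.cast_nonneg _) (pow_pos P.𝔔3_pos _).le

/-- **`Dclear3_J(s₁,τ) ≤ Dmax_k = 𝔔¹⁶ E(3^{k+1})`** at the points `s₁ < 3^{k+1+J} S₀` of the `k`-th inner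
step, `|τ| ≤ T` — the denominator half of `TwoSetup.KSizes3` (with p2's
`exists_int_Dclear3_mul_coreSum3`). [cite: Waldschmidt1980, §3.3 (3.19)–(3.21) (p. 269)] -/
theorem SizeHyp.Dclear3_le_DmaxK3 {J k : ℕ} {τ : Tau Q.d} (hτ : tauNorm τ ≤ P.T3)
    {s : ℕ} (hs : s < 3 ^ (k + 1 + J) * P.S₀3) :
    ((Q.Dclear3 (h := P.hparℓ) J P.L3 P.Lθ3 s τ : ℕ) : ℝ) ≤ P.DmaxK3 k := by
  have hτ1 : τ.1 ≤ P.T3 := by unfold tauNorm at hτ; omega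
  have hτ2 : ∑ j, τ.2 j ≤ P.T3 := by unfold tauNorm at hτ; omega
  have h := hy.cast_Dclear3_le hτ1 hτ2 (SetupQ.le_pow_mul_of_lt_step hs)
  refine h.trans ?_
  unfold PadicW80ParL.DmaxK3
  exact mul_le_mul_of_nonneg_right (pow_le_pow_right₀ P.one_le_𝔔3 (by norm_num)) (P.Efac3_pos _).le

/-- **`Dclear3_J(s,τ) ≤ DmaxT = 𝔔¹⁶ E(3)`** at the third points `s < 3^{J+1} S₀` of level `J`, `|τ| ≤ T`
— the bound of the denominator `D(s,τ) := Dclear3_J(s,τ)` of `TwoSetup.thirdStep_of_numerics` (with p2's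
`exists_int_Dclear3_mul_thirdWeight`). [cite: Yu1989, §3] [cite: Waldschmidt1980, §3.4 (3.22) (p. 270)] -/
theorem SizeHyp.Dclear3_le_DmaxT3 {J : ℕ} {τ : Tau Q.d} (hτ : tauNorm τ ≤ P.T3)
    {s : ℕ} (hs : s < 3 ^ (J + 1) * P.S₀3) :
    ((Q.Dclear3 (h := P.hparℓ) J P.L3 P.Lθ3 s τ : ℕ) : ℝ) ≤ P.DmaxT3 := by
  have hτ1 : τ.1 ≤ P.T3 := by unfold tauNorm at hτ; omega
  have hτ2 : ∑ j, τ.2 j ≤ P.T3 := by unfold tauNorm at hτ; omega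
  have h := hy.cast_Dclear3_le hτ1 hτ2 (SetupQ.le_pow_mul_of_lt_third hs)
  refine h.trans ?_
  unfold PadicW80ParL.DmaxT3
  push_cast
  exact mul_le_mul_of_nonneg_right (pow_le_pow_right₀ P.one_le_𝔔3 (by norm_num)) (P.Efac3_pos _).le

/-! #### The terms and the cores -/

/-- **`|qTerm3_{J₀,J}(u,τ,s)| ≤ 𝔔⁵ · E(c)`** on the box of level `J ≤ J₀`, `|τ| ≤ T`, at a point
`s ≤ 3ᴶ c S₀` with `c ≤ 3^{d+1}` (`|qΔ3| ≤ 𝔔⁴`, `|qA| ≤ 𝔔`, `|qE| ≤ E(c)`).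
[cite: Waldschmidt1980, §3.4 (3.21) (p. 269)] -/
theorem SizeHyp.abs_qTerm3_le_of_le {J : ℕ} (hJ : J ≤ P.J₀3) {u : Idx Q.d P.hparℓ P.Lb3}
    (hu : u ∈ Q.box3 (h := P.hparℓ) (Lb := P.Lb3) P.L3 P.Lθ3 J) {τ : Tau Q.d} (hτ : tauNorm τ ≤ P.T3)
    {c : ℕ} (hc : c ≤ 3 ^ (Q.d + 1)) {s : ℕ} (hs : s ≤ 3 ^ J * (c * P.S₀3)) :
    |(Q.qTerm3 P.J₀3 J u τ s : ℝ)| ≤ P.𝔔3 ^ 5 * P.Efac3 c := by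
  have hτ1 : τ.1 ≤ P.T3 := by unfold tauNorm at hτ; omega
  have hτ2 : ∑ j, τ.2 j ≤ P.T3 := by unfold tauNorm at hτ; omega
  have hs' : s ≤ 3 ^ (Q.d + 1 + J) * P.S₀3 := by
    calc s ≤ 3 ^ J * (c * P.S₀3) := hs
      _ ≤ 3 ^ J * (3 ^ (Q.d + 1) * P.S₀3) := Nat.mul_le_mul_left _ (Nat.mul_le_mul_right _ hc)
      _ = 3 ^ (Q.d + 1 + J) * P.S₀3 := by rw [pow_add]; ring
  unfold SetupQ.qTerm3; push_cast
  rw [abs_mul, abs_mul]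
  have h1 : |(Q.qΔ3 P.J₀3 J u τ.1 s : ℝ)| ≤ P.𝔔3 ^ 4 := abs_qΔ3_le_𝔔3_pow_four Q P hJ u hτ1 hs'
  have h2 : |(Q.flat.qA u τ.2 : ℝ)| ≤ P.𝔔3 ^ 1 := by rw [pow_one]; exact hy.abs_qA3_le_𝔔3 hu hτ2
  have h3 : |(Q.qE u s : ℝ)| ≤ P.Efac3 c := hy.abs_qE3_le hu hs
  have h12 := P.mul_le_𝔔3_pow h1 h2 (abs_nonneg _)
  exact mul_le_mul h12 h3 (abs_nonneg _) (pow_pos P.𝔔3_pos _).le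

/-- **`|qTerm3_{J₀,J}(u,τ,s₁)| ≤ 𝔔⁵ · E(3^{k+1})`** at the points `s₁ < 3^{k+1+J} S₀` of the `k`-th inner step
(`k ≤ d`) on the box of level `J ≤ J₀`, `|τ| ≤ T` — the per-term size behind `Mmax_k` of `TwoSetup.KSizes3`.
[cite: Waldschmidt1980, §3.3 (3.19)–(3.21) (p. 269)] [cite: Yu1989, §3 Lemma 3.3] -/
theorem SizeHyp.abs_qTerm3_le {J k : ℕ} (hJ : J ≤ P.J₀3) (hk : k ≤ Q.d) {u : Idx Q.d P.hparℓ P.Lb3}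
    (hu : u ∈ Q.box3 (h := P.hparℓ) (Lb := P.Lb3) P.L3 P.Lθ3 J) {τ : Tau Q.d} (hτ : tauNorm τ ≤ P.T3)
    {s : ℕ} (hs : s < 3 ^ (k + 1 + J) * P.S₀3) :
    |(Q.qTerm3 P.J₀3 J u τ s : ℝ)| ≤ P.𝔔3 ^ 5 * P.Efac3 ((3 ^ (k + 1) : ℕ) : ℝ) :=
  hy.abs_qTerm3_le_of_le hJ hu hτ (Nat.pow_le_pow_right (by norm_num) (by omega))
    (SetupQ.le_pow_mul_of_lt_step hs)

/-- **Siegel's coefficient bound `|Dclear3₀(s,τ) · qTerm3_{J₀,0}(u,τ,s)| ≤ Amax = 𝔔²¹ E(3)`** on the box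
of level `0`, `s < S₀`, `|τ| < T` (`D ≤ 𝔔³E(1)`, `|qTerm3| ≤ 𝔔⁵E(1)`, `E(1)² = E(2) ≤ E(3)`) — the
hypothesis `hA` of `TwoSetup.siegel3_of_count` with `Dc := Dclear3 0`.
[cite: Waldschmidt1980, Lemma 3.2 (pp. 266–267)] -/
theorem SizeHyp.abs_Dclear3_qTerm3_le_Amax3 {s : ℕ} (hs : s < P.S₀3) {τ : Tau Q.d} (hτ : tauNorm τ < P.T3)
    {u : Idx Q.d P.hparℓ P.Lb3} (hu : u ∈ Q.box3 (h := P.hparℓ) (Lb := P.Lb3) P.L3 P.Lθ3 0) :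
    |((Q.Dclear3 (h := P.hparℓ) 0 P.L3 P.Lθ3 s τ : ℕ) : ℝ) * (Q.qTerm3 P.J₀3 0 u τ s : ℝ)| ≤ P.Amax3 := by
  have hτ1 : τ.1 ≤ P.T3 := by unfold tauNorm at hτ; omega
  have hτ2 : ∑ j, τ.2 j ≤ P.T3 := by unfold tauNorm at hτ; omega
  have hs1 : s ≤ 3 ^ 0 * (1 * P.S₀3) := by simp; omega
  have hc : 1 ≤ 3 ^ (Q.d + 1) := Nat.one_le_pow _ _ (by norm_num)
  have h𝔔 := P.𝔔3_pos; have h𝔔1 := P.one_le_𝔔3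
  have hD : ((Q.Dclear3 (h := P.hparℓ) 0 P.L3 P.Lθ3 s τ : ℕ) : ℝ) ≤ P.𝔔3 ^ 3 * P.Efac3 (1 : ℕ) :=
    hy.cast_Dclear3_le hτ1 hτ2 hs1
  have hQ : |(Q.qTerm3 P.J₀3 0 u τ s : ℝ)| ≤ P.𝔔3 ^ 5 * P.Efac3 (1 : ℕ) :=
    hy.abs_qTerm3_le_of_le (Nat.zero_le _) hu hτ.le hc hs1
  rw [abs_mul, Nat.abs_cast]
  have hE : P.Efac3 (1 : ℕ) * P.Efac3 (1 : ℕ) ≤ P.Efac3 3 := by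
    unfold PadicW80ParL.Efac3
    rw [← Real.exp_add]; push_cast
    refine Real.exp_le_exp.mpr ?_
    have := P.𝔘3_pos; unfold cLp'; nlinarith
  have h8 : P.𝔔3 ^ 3 * P.𝔔3 ^ 5 ≤ P.𝔔3 ^ 21 := by
    rw [← pow_add]; exact pow_le_pow_right₀ h𝔔1 (by norm_num)
  calc ((Q.Dclear3 (h := P.hparℓ) 0 P.L3 P.Lθ3 s τ : ℕ) : ℝ) * |(Q.qTerm3 P.J₀3 0 u τ s : ℝ)|
      ≤ (P.𝔔3 ^ 3 * P.Efac3 (1 : ℕ)) * (P.𝔔3 ^ 5 * P.Efac3 (1 : ℕ)) :=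
        mul_le_mul hD hQ (abs_nonneg _) (mul_nonneg (pow_pos h𝔔 _).le (P.Efac3_pos _).le)
    _ = (P.𝔔3 ^ 3 * P.𝔔3 ^ 5) * (P.Efac3 (1 : ℕ) * P.Efac3 (1 : ℕ)) := by ring
    _ ≤ P.𝔔3 ^ 21 * P.Efac3 3 :=
        mul_le_mul h8 hE (mul_nonneg (P.Efac3_pos _).le (P.Efac3_pos _).le) (pow_pos h𝔔 _).le
    _ = P.Amax3 := by unfold PadicW80ParL.Amax3; ring

/-- **`|coreSum3_{J₀,J}(τ,s₁)| ≤ Mmax_k = 𝔔 · PrV · 𝔔⁵ E(3^{k+1})`** over the box of level `J ≤ J₀` for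
integer coefficients `|p(u)| ≤ P_int ≤ PrV`, `|τ| ≤ T`, `k ≤ d`, `s₁ < 3^{k+1+J} S₀`
(`#box3_J ≤ 𝔔`, `|qTerm3| ≤ 𝔔⁵E(3^{k+1})`) — the size half of `TwoSetup.KSizes3`.
[cite: Waldschmidt1980, §3.3 (3.19)–(3.21) (p. 269)] [cite: Yu1989, §3 Lemma 3.3] -/
theorem SizeHyp.abs_coreSum3_le_MmaxK3 {J : ℕ} (hJ : J ≤ P.J₀3) {pv : Idx Q.d P.hparℓ P.Lb3 → ℤ}
    {Pint : ℤ} (hpv : ∀ u, |pv u| ≤ Pint) (hPint : (Pint : ℝ) ≤ P.PrV3)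
    {τ : Tau Q.d} (hτ : tauNorm τ ≤ P.T3) {k : ℕ} (hk : k ≤ Q.d) {s : ℕ} (hs : s < 3 ^ (k + 1 + J) * P.S₀3) :
    |(Q.coreSum3 P.J₀3 J (Q.box3 (h := P.hparℓ) (Lb := P.Lb3) P.L3 P.Lθ3 J) pv τ s : ℝ)| ≤ P.MmaxK3 k := by
  classical
  have hPr : (0 : ℝ) ≤ P.PrV3 := P.PrV3_pos.le
  have hB0 : 0 ≤ P.𝔔3 ^ 5 * P.Efac3 ((3 ^ (k + 1) : ℕ) : ℝ) := by
    have := P.𝔔3_pos; have := P.Efac3_pos ((3 ^ (k + 1) : ℕ) : ℝ); positivity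
  have hterm : ∀ u ∈ Q.box3 (h := P.hparℓ) (Lb := P.Lb3) P.L3 P.Lθ3 J,
      |(pv u : ℝ)| * |(Q.qTerm3 P.J₀3 J u τ s : ℝ)| ≤ P.PrV3 * (P.𝔔3 ^ 5 * P.Efac3 ((3 ^ (k + 1) : ℕ) : ℝ)) := by
    intro u hu
    have hq : |(Q.qTerm3 P.J₀3 J u τ s : ℝ)| ≤ P.𝔔3 ^ 5 * P.Efac3 ((3 ^ (k + 1) : ℕ) : ℝ) :=
      hy.abs_qTerm3_le hJ hk hu hτ hs
    have hp : |(pv u : ℝ)| ≤ P.PrV3 := le_trans (by exact_mod_cast hpv u) hPint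
    exact mul_le_mul hp hq (abs_nonneg _) hPr
  have hcard := Q.card_box3_le_𝔔3 P J
  unfold SetupQ.coreSum3
  push_cast
  calc |∑ u ∈ Q.box3 (h := P.hparℓ) (Lb := P.Lb3) P.L3 P.Lθ3 J, (pv u : ℝ) * (Q.qTerm3 P.J₀3 J u τ s : ℝ)|
      ≤ ∑ u ∈ Q.box3 (h := P.hparℓ) (Lb := P.Lb3) P.L3 P.Lθ3 J,
          |(pv u : ℝ) * (Q.qTerm3 P.J₀3 J u τ s : ℝ)| := abs_sum_le_sum_abs _ _
    _ ≤ ∑ u ∈ Q.box3 (h := P.hparℓ) (Lb := P.Lb3) P.L3 P.Lθ3 J,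
          P.PrV3 * (P.𝔔3 ^ 5 * P.Efac3 ((3 ^ (k + 1) : ℕ) : ℝ)) :=
        sum_le_sum fun u hu => by rw [abs_mul]; exact hterm u hu
    _ = (Q.box3 (h := P.hparℓ) (Lb := P.Lb3) P.L3 P.Lθ3 J).card *
          (P.PrV3 * (P.𝔔3 ^ 5 * P.Efac3 ((3 ^ (k + 1) : ℕ) : ℝ))) := by rw [sum_const, nsmul_eq_mul]
    _ ≤ P.𝔔3 * (P.PrV3 * (P.𝔔3 ^ 5 * P.Efac3 ((3 ^ (k + 1) : ℕ) : ℝ))) :=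
        mul_le_mul_of_nonneg_right hcard (mul_nonneg hPr hB0)
    _ = P.MmaxK3 k := by unfold PadicW80ParL.MmaxK3; ring

/-! #### The third-point weights -/

/-- **`|qΔ3_{J₀,J+1}(u;τ₀,s) · qA(u,τ') · qEt(u,s)| ≤ RThird = 𝔔⁵ E(3)`** on the box of level `J < J₀`,
`|τ| ≤ T`, `s < 3^{J+1} S₀` (`|qΔ3| ≤ 𝔔⁴`, `|qA| ≤ 𝔔`, `|qEt| ≤ E(3)`): one weight of the triadic class
sums at a third point. [cite: Yu1989, §3] [cite: Waldschmidt1980, §3.4 (3.22) (p. 270)] -/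
theorem SizeHyp.abs_thirdWeight_le_RThird3 {J : ℕ} (hJ : J < P.J₀3) {u : Idx Q.d P.hparℓ P.Lb3}
    (hu : u ∈ Q.box3 (h := P.hparℓ) (Lb := P.Lb3) P.L3 P.Lθ3 J) {τ : Tau Q.d} (hτ : tauNorm τ ≤ P.T3)
    {s : ℕ} (hs : s < 3 ^ (J + 1) * P.S₀3) :
    |((Q.qΔ3 P.J₀3 (J + 1) u τ.1 s * Q.flat.qA u τ.2 * Q.qEt u s : ℚ) : ℝ)| ≤ P.RThird3 := by
  have hτ1 : τ.1 ≤ P.T3 := by unfold tauNorm at hτ; omega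
  have hτ2 : ∑ j, τ.2 j ≤ P.T3 := by unfold tauNorm at hτ; omega
  have hs' : s ≤ 3 ^ (Q.d + 1 + (J + 1)) * P.S₀3 := by
    have : 3 ^ (J + 1) * P.S₀3 ≤ 3 ^ (Q.d + 1 + (J + 1)) * P.S₀3 :=
      Nat.mul_le_mul_right _ (Nat.pow_le_pow_right (by norm_num) (by omega))
    omega
  push_cast
  rw [abs_mul, abs_mul]
  have h1 : |(Q.qΔ3 P.J₀3 (J + 1) u τ.1 s : ℝ)| ≤ P.𝔔3 ^ 4 := abs_qΔ3_le_𝔔3_pow_four Q P hJ u hτ1 hs'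
  have h2 : |(Q.flat.qA u τ.2 : ℝ)| ≤ P.𝔔3 ^ 1 := by rw [pow_one]; exact hy.abs_qA3_le_𝔔3 hu hτ2
  have h3 : |(Q.qEt u s : ℝ)| ≤ P.Efac3 (3 : ℕ) := hy.abs_qEt3_le hu (SetupQ.le_pow_mul_of_lt_third hs)
  have h12 := P.mul_le_𝔔3_pow h1 h2 (abs_nonneg _)
  unfold PadicW80ParL.RThird3
  push_cast at h3
  exact mul_le_mul h12 h3 (abs_nonneg _) (pow_pos P.𝔔3_pos _).le

/-- **`∑_{u ∈ box3_J} P_int · |qΔ3_{J₀,J+1} qA qEt(u)| ≤ MmaxT = 𝔔 · PrV · RThird`** for `P_int ≤ PrV`,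
`J < J₀`, `|τ| ≤ T`, `s < 3^{J+1} S₀` (`#box3_J ≤ 𝔔`) — the hypothesis `hMbP` of
`TwoSetup.thirdStep_of_numerics` with `Mb := MmaxT3`. [cite: Yu1989, §3] [cite: Waldschmidt1980, §3.4 (p. 270)] -/
theorem SizeHyp.sum_thirdWeight_le_MmaxT3 {J : ℕ} (hJ : J < P.J₀3) {τ : Tau Q.d} (hτ : tauNorm τ ≤ P.T3)
    {s : ℕ} (hs : s < 3 ^ (J + 1) * P.S₀3) {Pint : ℤ} (hP : (Pint : ℝ) ≤ P.PrV3) :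
    ∑ u ∈ Q.box3 (h := P.hparℓ) (Lb := P.Lb3) P.L3 P.Lθ3 J,
        (Pint : ℝ) * |((Q.qΔ3 P.J₀3 (J + 1) u τ.1 s * Q.flat.qA u τ.2 * Q.qEt u s : ℚ) : ℝ)| ≤ P.MmaxT3 := by
  have hcard := Q.card_box3_le_𝔔3 P J
  have hR0 : 0 ≤ P.RThird3 := P.RThird3_pos.le
  have hPr0 : 0 ≤ P.PrV3 := P.PrV3_pos.le
  calc ∑ u ∈ Q.box3 (h := P.hparℓ) (Lb := P.Lb3) P.L3 P.Lθ3 J,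
        (Pint : ℝ) * |((Q.qΔ3 P.J₀3 (J + 1) u τ.1 s * Q.flat.qA u τ.2 * Q.qEt u s : ℚ) : ℝ)|
      ≤ ∑ u ∈ Q.box3 (h := P.hparℓ) (Lb := P.Lb3) P.L3 P.Lθ3 J, P.PrV3 * P.RThird3 :=
        sum_le_sum fun u hu => mul_le_mul hP (hy.abs_thirdWeight_le_RThird3 hJ hu hτ hs) (abs_nonneg _) hPr0
    _ = (Q.box3 (h := P.hparℓ) (Lb := P.Lb3) P.L3 P.Lθ3 J).card * (P.PrV3 * P.RThird3) := by
        rw [sum_const, nsmul_eq_mul]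
    _ ≤ P.𝔔3 * (P.PrV3 * P.RThird3) := mul_le_mul_of_nonneg_right hcard (mul_nonneg hPr0 hR0)
    _ = P.MmaxT3 := by unfold PadicW80ParL.MmaxT3; ring

end Setup

end Literature.NumberTheory.Transcendental.CW77

end
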